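import Summits.Ventures.AbcSig.Levels.N7328P1
import Summits.Ventures.AbcSig.Levels.N7328P2
import Summits.Ventures.AbcSig.Levels.N7328Q1
import Summits.Ventures.AbcSig.Levels.N7328S2
import Summits.Ventures.AbcSig.Levels.N7328S3

/-!
# Venture AbcSig — GENERATED level file, level 7328 (AGGREGATOR of 5 part files)

HONEST FRAMING. As in the part files `N7328P<i>.lean` (same generator run, same certified level file
`N7328.engine1.json`, sha256 `628d8f2bbd4094737bddb4628a7ad74a0c58d63707726e548b5b19b69e5656f0`): this file only concatenates the orbit lists and the part summaries into
`level7328Orbits`, `level7328_wellformed`, `level7328_sieve` (the shapes the row templates consume). The split exists because the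
tree's files are ≤ 400 lines. Union of residual exponents ≥ 7: [7, 13]; orbits not eliminable by the sieve:
none. No Diophantine statement is made here; no claim on ABC or any summit.
-/

namespace Summit.Ventures.AbcSig

/-- All newform orbits of level 7328 (concatenation of the parts, engine order). -/
def level7328Orbits : List OrbitData :=
  level7328OrbitsP1 ++ level7328OrbitsP2 ++ level7328OrbitsQ1 ++ level7328OrbitsS2 ++ level7328OrbitsS3

/-- Every listed entry is at an odd prime not dividing 7328. -/
theorem level7328_wellformed :
    ∀ o ∈ level7328Orbits, ∀ e ∈ o.coeffs, e.ell.Prime ∧ e.ell ≠ 2 ∧ ¬ e.ell ∣ 7328 := by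
  unfold level7328Orbits
  exact List.forall_mem_append.2 ⟨List.forall_mem_append.2 ⟨List.forall_mem_append.2 ⟨List.forall_mem_append.2 ⟨level7328_wellformedP1, level7328_wellformedP2⟩, level7328_wellformedQ1⟩, level7328_wellformedS2⟩, level7328_wellformedS3⟩

/-- **Level 7328 summary.** For a prime exponent `n ≥ 7`, every orbit of level 7328 is sieve-eliminated by the
kernel certificates of the part files, except that the row's predicate `X` is assumed for: orbit_7328_8 if n ∈ [13], orbit_7328_9 if n ∈ [13], orbit_7328_10 if n ∈ [7, 13], orbit_7328_11 if n ∈ [7], orbit_7328_12 if n ∈ [7]. -/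
theorem level7328_sieve (n : ℕ) (hn : n.Prime) (hmin : 7 ≤ n) (X : OrbitData → Prop)
    (h_orbit_7328_8 : n ∈ ([13] : List ℕ) → X orbit_7328_8)
    (h_orbit_7328_9 : n ∈ ([13] : List ℕ) → X orbit_7328_9)
    (h_orbit_7328_10 : n ∈ ([7, 13] : List ℕ) → X orbit_7328_10)
    (h_orbit_7328_11 : n ∈ ([7] : List ℕ) → X orbit_7328_11)
    (h_orbit_7328_12 : n ∈ ([7] : List ℕ) → X orbit_7328_12) :
    ∀ o ∈ level7328Orbits, (∀ e ∈ o.coeffs, e.ell.Prime ∧ e.ell ≠ 2 ∧ ¬ e.ell ∣ 7328) ∧ (o.Eliminated bs04Allowed n ∨ X o) := by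
  unfold level7328Orbits
  exact List.forall_mem_append.2 ⟨List.forall_mem_append.2 ⟨List.forall_mem_append.2 ⟨List.forall_mem_append.2 ⟨(level7328_sieveP1 n hn hmin X), (level7328_sieveP2 n hn hmin X h_orbit_7328_8 h_orbit_7328_9 h_orbit_7328_10)⟩, (level7328_sieveQ1 n hn hmin X h_orbit_7328_11)⟩, (level7328_sieveS2 n hn hmin X h_orbit_7328_12)⟩, (level7328_sieveS3 n hn hmin X)⟩

end Summit.Ventures.AbcSig
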